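import Mathlib
import HarnessLib
import Summits.HubbardSuperconductivity.HubbardSuperconductivity.Theorems.KLProgrammeKLRegimeCountertermContinuationJ
import Summits.HubbardSuperconductivity.HubbardSuperconductivity.Theorems.KLProgrammeKLRegimeCountertermReadingFn

/-!
# Route `KLProgramme` — child Counterterm of crux K3 at GEN 5 (`CountertermP2 klPredsV13 klWindowC`, Δ23 / (R-I-min)):
# THE ONE-VOLUME CONSTRUCTION WITH THE SMOOTHED STEP — thresholds, the degree `d(β, U, G, R)`, the exact reading
# (seat hubbard-kl-k3c3-p2, «fixed point on FrameOK's tube (contraction in the frame norm)»)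

Second half of `…CountertermContinuationJ` (twin of `…CountertermOneVolumeHA` for function pieces):
* §1 `ct_exists_postJE` / `ct_oneVolume_of_readingJE` — the induction over the levels with the pre-step bound `2·twoLegBar 0 m + 2(1+q)η`
  (the smoothing displacement `η` carried as a FLOOR of the bookkeeping bound, so that only ONE smallness condition on `η` remains:
  `(1+q)(1+2q)·η ≤ |U|·16^{−m}/256`, `m ≤ nScales β` — no positivity of `twoLegBar 0` is needed);
* §2 `sharpRoom_of_rooms` — the sharp room of `frameOK_jackson_of_multiSlotFn′` from `ctRenMs_thresholds`' two rooms;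
* §3 **`ct_oneVolume_thresholdsJ`** — child 2's constants `c₁, U₀` (from `ctRenMs_thresholds` and k3c3-p1's EXACT reading
  `klLocalPart_eq_partialSumFn_of_frameOK`, p486xxx `…CountertermReadingFn`) and ONE volume `(L₀, M₀)` beyond any given thresholds with
  `CL n / L₀ ≤ ½·tol_n`, at which EVERY gen-5 block (any history `H`) for the package `ctRenMs G` yields an admissible `TrigPolyC4v` frame within HALF
  the quadratic tolerance at every scale and angle — the Jackson degree `d` is chosen HERE, after `β` and `U`, before nothing else is read
  (`exists_nat_gt`), and never meets `L`.
Proofs only; nothing is asserted about the Hubbard model.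
-/

noncomputable section

namespace Summit.HubbardSuperconductivity.HubbardSuperconductivity.Theorems.KLRegimeSplit

set_option linter.dupNamespace false -- summit = problem name (single-conjunct summit), D-0017

open Real Finset
open Literature.MathematicalPhysics.QuantumLattice Literature.Probability.LatticeModels
open Summit.HubbardSuperconductivity.HubbardSuperconductivity.Theorems.KLProgrammeLegKernels

/-! ## §1 The induction over the levels with the displacement as a floor -/

section Main

variable {L M : ℕ} [NeZero L] [NeZero M] {G : GeoConsts} {Q : EngConsts} {β U μ : ℝ} {R : RenConsts}
  {H : TrigPolyC4v → ℕ → Prop}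

/-- **The induction over the levels, displacement as a floor**: for every `n ≤ N` there is an admissible frame, renormalised at every `j ≤ n`,
with `sup|S_j(K)| ≤ T̄_{j,n} + q·(2·twoLegBar 0 n + 2(1+q)η + η) + η` for `j ≤ n`, under the single condition
`(1+q)(1+2q)η ≤ |U|16^{−m}/256` (`m ≤ N`). -/
theorem ct_exists_postJE (hG : G.WF) (hQ : Q.WF) (hμ : μ ∈ klWindowC) (hR : ∀ j, 0 ≤ R.Gfr j) (hcr : R.cr = ctCr G)
    (blk : ∀ K : TrigPolyC4v, FrameOK R U (nScales β) μ K → ∀ n : ℕ, n ≤ nScales β →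
      (∀ j < n, RenormalisedAtF L M β U μ K R j) →
        TwoLegSizesFn L M G Q R β U μ K.eval n ∧ FrameLipschitzFnT L M H G Q R β U μ K n ∧
          TwoLegSizesMSFn L M G Q R β U μ K.eval n ∧ (RenormalisedAtF L M β U μ K R n → H K n))
    (hread : ∀ K : TrigPolyC4v, FrameOK R U (nScales β) μ K → ∀ n : ℕ, n ≤ nScales β → ∀ B : ℝ,
        (∀ q : Fin 2 → ℝ, |K.eval q + ∑ i ∈ range (n + 1), klTwoLegPieceFn L M β U μ K.eval i q| ≤ B) →
          ∀ θ : ℝ, |klLocalPart L M β U μ K n θ| ≤ B)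
    (hS0' : Q.S' 0 * |U| ≤ 1 / 10) (hq : 4 / 3 * (G.SL + Q.SL * |U|) * |U| ≤ 1 / 1000)
    (hroom : ∀ n ≤ nScales β, ∀ j ≤ 4, G.S j + Q.S' j * |U| + (∑ i ∈ range (n + 1), msBar G Q U i) * R.Gfr j ≤ R.Gfr j)
    (h0 : ∑ m ∈ range (nScales β + 1), R.Gfr 0 * uPow 0 U * (4 : ℝ) ^ (((0 : ℤ) - 2) * m) ≤ 3 / 80)
    (h1 : ∑ m ∈ range (nScales β + 1), R.Gfr 1 * uPow 1 U * (4 : ℝ) ^ (((1 : ℤ) - 2) * m) ≤ 1 / 2000)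
    (h2 : ∑ m ∈ range (nScales β + 1), ∑ j ∈ range 3, R.Gfr j * uPow j U * (4 : ℝ) ^ (((j : ℤ) - 2) * m) ≤ 1 / 100)
    (d : ℕ) {η : ℝ} (hη : π ^ 6 / (d + 1) * ∑ i ∈ range (nScales β + 1), twoLegBar G Q U 1 i ≤ η)
    (hηw : ∀ m ≤ nScales β,
      (1 + 4 / 3 * (G.SL + Q.SL * |U|) * |U|) * (1 + 2 * (4 / 3 * (G.SL + Q.SL * |U|) * |U|)) * η ≤ |U| * ((16 : ℝ) ^ m)⁻¹ / 256)
    (n : ℕ) (hn : n ≤ nScales β) :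
    ∃ K : TrigPolyC4v, FrameOK R U (nScales β) μ K ∧ (∀ j ≤ n, RenormalisedAtF L M β U μ K R j) ∧
      ∀ j ≤ n, ∀ q : Fin 2 → ℝ, |K.eval q + ∑ i ∈ range (j + 1), klTwoLegPieceFn L M β U μ K.eval i q| ≤
        ∑ i ∈ Ico (j + 1) (n + 1), twoLegBar G Q U 0 i +
          4 / 3 * (G.SL + Q.SL * |U|) * |U| *
            (2 * twoLegBar G Q U 0 n + 2 * (1 + 4 / 3 * (G.SL + Q.SL * |U|) * |U|) * η + η) + η := by
  set qq : ℝ := 4 / 3 * (G.SL + Q.SL * |U|) * |U| with hqq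
  have htlb0 : ∀ i, 0 ≤ twoLegBar G Q U 0 i := fun i => twoLegBar_nonneg' hG hQ U 0 i
  have htlb1 : ∀ i, 0 ≤ twoLegBar G Q U 1 i := fun i => twoLegBar_nonneg' hG hQ U 1 i
  have hSL : 0 ≤ G.SL := hG.2.2.2.2.2.2.2.2.2.2.2.2.2.2.2.2.2.2.2
  have hSL' : 0 ≤ Q.SL := hQ.2.2.2.2.2.2.1
  have hqq0 : 0 ≤ qq := by positivity
  have hη0 : 0 ≤ η := le_trans (mul_nonneg (by positivity) (sum_nonneg fun i _ => htlb1 i)) hη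
  -- feasibility of a step at level `m` with pre-step bound `2·twoLegBar 0 m + 2(1+q)η`
  have hfeas : ∀ m ≤ nScales β, ∀ j ≤ m,
      ∑ i ∈ Ico (j + 1) (m + 1), twoLegBar G Q U 0 i + qq * (2 * twoLegBar G Q U 0 m + 2 * (1 + qq) * η + η) + η ≤
        ctCr G * |U| * klScale klE0 j ^ 2 / klE0 := by
    intro m hm j hj
    have h := ct_budget (β := β) (fun _ => (1 + qq) * (1 + 2 * qq) * η) hG hQ (fun k hk => hηw k hk) hS0' hq hj hm
    beta_reduce at h
    rw [← hqq] at h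
    have hS : 0 ≤ G.S 0 := hG.2.2.2.2.2.2.2.2.2.2.2.2.2.2.2.2.2.1 0
    have hcr0 : 0 ≤ ctCr G := by unfold ctCr; positivity
    have he0 : (0 : ℝ) < klE0 := by norm_num [klE0]
    have htolpos : 0 ≤ ctCr G * |U| * klScale klE0 j ^ 2 / klE0 := by positivity
    have e : qq * (2 * twoLegBar G Q U 0 m + 2 * (1 + qq) * η + η) + η =
        qq * (2 * twoLegBar G Q U 0 m) + (1 + qq) * (1 + 2 * qq) * η := by ring
    linarith
  induction n with
  | zero =>
    have hzero : FrameOK R U (nScales β) μ (0 : TrigPolyC4v) := by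
      refine frameOK_of_pieces hR hμ (K := 0) (Kp := fun _ => 0) (N := nScales β) (fun p => by simp [eval_fsub]) ?_ h0 h1 h2
      intro m _ j _ q
      rw [evalM_zero_eq, iteratedFDeriv_fun_zero]
      simp only [Pi.zero_apply, norm_zero]
      exact mul_nonneg (mul_nonneg (hR j) (uPow_nonneg j U)) (zpow_nonneg (by norm_num) _)
    have hpre : ∀ q : Fin 2 → ℝ, |(0 : TrigPolyC4v).eval q + ∑ i ∈ range (0 + 1),
        klTwoLegPieceFn L M β U μ (0 : TrigPolyC4v).eval i q| ≤ 2 * twoLegBar G Q U 0 0 + 2 * (1 + qq) * η := by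
      intro q
      rw [TrigPolyC4v.eval_zero, zero_add, zero_add, sum_range_one]
      have := abs_pieceFn_le_of_blockJ blk hzero (i := 0) (Nat.zero_le _) (fun j hj => absurd hj (Nat.not_lt_zero j)) q
      nlinarith [htlb0 0, hqq0, hη0]
    obtain ⟨hK', hren', hS'⟩ := ct_stepJ hG hQ hμ hR hcr blk hread hroom h0 h1 h2 d hη hzero (Nat.zero_le _)
      (fun j hj => absurd hj (Nat.not_lt_zero j)) (by nlinarith [htlb0 0, hqq0, hη0]) hpre (hfeas 0 hn)
    exact ⟨_, hK', hren', hS'⟩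
  | succ n ih =>
    obtain ⟨K, hK, hren, hS⟩ := ih (Nat.le_of_succ_le hn)
    have hSn : ∀ q : Fin 2 → ℝ, |K.eval q + ∑ i ∈ range (n + 1), klTwoLegPieceFn L M β U μ K.eval i q| ≤
        qq * (2 * twoLegBar G Q U 0 n + 2 * (1 + qq) * η + η) + η := by
      intro q
      have h := hS n le_rfl q
      rwa [Finset.Ico_self, sum_empty, zero_add] at h
    obtain ⟨hren', hpre⟩ := ct_levelUpJ blk hK hn hren hSn
    have hpre' : ∀ q : Fin 2 → ℝ, |K.eval q + ∑ i ∈ range (n + 1 + 1), klTwoLegPieceFn L M β U μ K.eval i q| ≤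
        2 * twoLegBar G Q U 0 (n + 1) + 2 * (1 + qq) * η := by
      intro q
      refine (hpre q).trans ?_
      have h16 : twoLegBar G Q U 0 n = 16 * twoLegBar G Q U 0 (n + 1) := by
        simp only [ct_twoLegBar_zero_eq, pow_succ, mul_inv]
        ring
      rw [h16]
      have e : qq * (2 * (16 * twoLegBar G Q U 0 (n + 1)) + 2 * (1 + qq) * η + η) + η =
          32 * qq * twoLegBar G Q U 0 (n + 1) + (1 + qq) * (1 + 2 * qq) * η := by ring
      rw [e]
      nlinarith [htlb0 (n + 1), mul_nonneg hqq0 hη0, mul_nonneg (mul_nonneg hqq0 hqq0) hη0]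
    obtain ⟨hK', hren'', hS'⟩ := ct_stepJ hG hQ hμ hR hcr blk hread hroom h0 h1 h2 d hη hK hn hren'
      (by nlinarith [htlb0 (n + 1), hqq0, hη0]) hpre' (hfeas (n + 1) hn)
    exact ⟨_, hK', hren'', hS'⟩

/-- **THE ONE-VOLUME CONTINUATION WITH THE SMOOTHED STEP, GIVEN THE EXACT READING** (displacement as a floor; single `η` condition). -/
theorem ct_oneVolume_of_readingJE (hG : G.WF) (hQ : Q.WF) (hμ : μ ∈ klWindowC) (hR : ∀ j, 0 ≤ R.Gfr j) (hcr : R.cr = ctCr G)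
    (blk : ∀ K : TrigPolyC4v, FrameOK R U (nScales β) μ K → ∀ n : ℕ, n ≤ nScales β →
      (∀ j < n, RenormalisedAtF L M β U μ K R j) →
        TwoLegSizesFn L M G Q R β U μ K.eval n ∧ FrameLipschitzFnT L M H G Q R β U μ K n ∧
          TwoLegSizesMSFn L M G Q R β U μ K.eval n ∧ (RenormalisedAtF L M β U μ K R n → H K n))
    (hread : ∀ K : TrigPolyC4v, FrameOK R U (nScales β) μ K → ∀ n : ℕ, n ≤ nScales β → ∀ B : ℝ,
        (∀ q : Fin 2 → ℝ, |K.eval q + ∑ i ∈ range (n + 1), klTwoLegPieceFn L M β U μ K.eval i q| ≤ B) →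
          ∀ θ : ℝ, |klLocalPart L M β U μ K n θ| ≤ B)
    (hS0' : Q.S' 0 * |U| ≤ 1 / 10) (hq : 4 / 3 * (G.SL + Q.SL * |U|) * |U| ≤ 1 / 1000)
    (hroom : ∀ n ≤ nScales β, ∀ j ≤ 4, G.S j + Q.S' j * |U| + (∑ i ∈ range (n + 1), msBar G Q U i) * R.Gfr j ≤ R.Gfr j)
    (h0 : ∑ m ∈ range (nScales β + 1), R.Gfr 0 * uPow 0 U * (4 : ℝ) ^ (((0 : ℤ) - 2) * m) ≤ 3 / 80)
    (h1 : ∑ m ∈ range (nScales β + 1), R.Gfr 1 * uPow 1 U * (4 : ℝ) ^ (((1 : ℤ) - 2) * m) ≤ 1 / 2000)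
    (h2 : ∑ m ∈ range (nScales β + 1), ∑ j ∈ range 3, R.Gfr j * uPow j U * (4 : ℝ) ^ (((j : ℤ) - 2) * m) ≤ 1 / 100)
    (d : ℕ) {η : ℝ} (hη : π ^ 6 / (d + 1) * ∑ i ∈ range (nScales β + 1), twoLegBar G Q U 1 i ≤ η)
    (hηw : ∀ m ≤ nScales β,
      (1 + 4 / 3 * (G.SL + Q.SL * |U|) * |U|) * (1 + 2 * (4 / 3 * (G.SL + Q.SL * |U|) * |U|)) * η ≤ |U| * ((16 : ℝ) ^ m)⁻¹ / 256) :
    ∃ K : TrigPolyC4v, FrameOK R U (nScales β) μ K ∧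
      ∀ n ≤ nScales β, ∀ θ : ℝ, |klLocalPart L M β U μ K n θ| ≤ ctCr G * |U| * klScale klE0 n ^ 2 / klE0 / 2 := by
  set qq : ℝ := 4 / 3 * (G.SL + Q.SL * |U|) * |U| with hqq
  obtain ⟨K, hK, -, hS⟩ :=
    ct_exists_postJE hG hQ hμ hR hcr blk hread hS0' hq hroom h0 h1 h2 d hη hηw (nScales β) le_rfl
  refine ⟨K, hK, fun n hn θ => ?_⟩; have h := hread K hK n hn _ (hS n hn) θ
  have hb := ct_budget (β := β) (fun _ => (1 + qq) * (1 + 2 * qq) * η) hG hQ (fun k hk => hηw k hk) hS0' hq hn le_rfl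
  beta_reduce at hb
  rw [← hqq] at hb h
  have e : qq * (2 * twoLegBar G Q U 0 (nScales β) + 2 * (1 + qq) * η + η) + η =
      qq * (2 * twoLegBar G Q U 0 (nScales β)) + (1 + qq) * (1 + 2 * qq) * η := by ring
  linarith

end Main

/-! ## §2 The sharp room from the two rooms of `ctRenMs_thresholds` -/

/-- `2(S_j + S′_j|U|) ≤ Gfr_j` and `Σ_{i≤n} msBar i ≤ ½` give the sharp room `S_j + S′_j|U| + (Σ msBar)·Gfr_j ≤ Gfr_j`. -/
theorem sharpRoom_of_rooms {G : GeoConsts} {Q : EngConsts} {R : RenConsts} (hR : ∀ j, 0 ≤ R.Gfr j) {U : ℝ}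
    (hroomA : ∀ j ≤ 4, 2 * (G.S j + Q.S' j * |U|) ≤ R.Gfr j) (hroomB : ∀ n : ℕ, ∑ i ∈ range (n + 1), msBar G Q U i ≤ 1 / 2)
    (N : ℕ) : ∀ n ≤ N, ∀ j ≤ 4, G.S j + Q.S' j * |U| + (∑ i ∈ range (n + 1), msBar G Q U i) * R.Gfr j ≤ R.Gfr j := by
  intro n _ j hj
  have hA := hroomA j hj
  have hB := mul_le_mul_of_nonneg_right (hroomB n) (hR j)
  linarith

/-! ## §3 The thresholds of the one-volume construction (gen 5) -/

/-- **THRESHOLDS AND THE VOLUME OF CHILD 2's CONSTRUCTION, gen 5 (function pieces, smoothed step, exact reading).**  For `G, Q` there are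
`c₁ > 0` and `U₀(c) > 0` such that for `0 < c ≤ c₁`, `0 < U ≤ U₀`, `klBetaMin ≤ β ≤ e^{c/U²}`, `μ ∈ klWindowC`, any thresholds `Lh, Mh, M0` and
any rates `CL n ≥ 0`: there is ONE volume `(L₀, M₀)` with `Lh ≤ L₀`, `Mh L₀ ≤ M₀`, `M0 L₀ ≤ M₀`, `CL n / L₀ ≤ ½·tol_n` (`n ≤ nScales β`), at which
EVERY gen-5 block for the package `ctRenMs G` (any history `H`) yields an admissible `TrigPolyC4v` frame whose local parts are within HALF the
quadratic tolerance `ctCr G·|U|·Λ_n²/e₀` at every scale and every real angle. -/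
theorem ct_oneVolume_thresholdsJ (G : GeoConsts) (Q : EngConsts) (hG : G.WF) (hQ : Q.WF) :
    ∃ c₁ : ℝ, 0 < c₁ ∧ ∀ c : ℝ, 0 < c → c ≤ c₁ → ∃ U₀ : ℝ, 0 < U₀ ∧
      ∀ μ ∈ klWindowC, ∀ U : ℝ, 0 < U → U ≤ U₀ → ∀ β : ℝ, klBetaMin ≤ β → β ≤ Real.exp (c / U ^ 2) →
        ∀ (Lh : ℕ) (Mh M0 : ℕ → ℕ) (CL : ℕ → ℝ), (∀ n, 0 ≤ CL n) →
          ∃ (L₀ M₀ : ℕ), 0 < L₀ ∧ 0 < M₀ ∧ Lh ≤ L₀ ∧ Mh L₀ ≤ M₀ ∧ M0 L₀ ≤ M₀ ∧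
            (∀ n ≤ nScales β, CL n / L₀ ≤ ctCr G * |U| * klScale klE0 n ^ 2 / klE0 / 2) ∧
            ∀ (_ : NeZero L₀) (_ : NeZero M₀) (H : TrigPolyC4v → ℕ → Prop),
              (∀ K : TrigPolyC4v, FrameOK (ctRenMs G) U (nScales β) μ K → ∀ n : ℕ, n ≤ nScales β →
                (∀ j < n, RenormalisedAtF L₀ M₀ β U μ K (ctRenMs G) j) →
                  TwoLegSizesFn L₀ M₀ G Q (ctRenMs G) β U μ K.eval n ∧ FrameLipschitzFnT L₀ M₀ H G Q (ctRenMs G) β U μ K n ∧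
                    TwoLegSizesMSFn L₀ M₀ G Q (ctRenMs G) β U μ K.eval n ∧
                      (RenormalisedAtF L₀ M₀ β U μ K (ctRenMs G) n → H K n)) →
              ∃ K : TrigPolyC4v, FrameOK (ctRenMs G) U (nScales β) μ K ∧
                ∀ n ≤ nScales β, ∀ θ : ℝ, |klLocalPart L₀ M₀ β U μ K n θ| ≤ ctCr G * |U| * klScale klE0 n ^ 2 / klE0 / 2 := by
  have hR : ∀ j, 0 ≤ (ctRenMs G).Gfr j := (ctRenMs_WF2 hG).1.2.2
  have hS0 : 0 ≤ G.S 0 := hG.2.2.2.2.2.2.2.2.2.2.2.2.2.2.2.2.2.1 0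
  have hS'0 : 0 ≤ Q.S' 0 := hQ.2.2.2.2.1 0
  have hSL : 0 ≤ G.SL := hG.2.2.2.2.2.2.2.2.2.2.2.2.2.2.2.2.2.2.2
  have hSL' : 0 ≤ Q.SL := hQ.2.2.2.2.2.2.1
  obtain ⟨c₂, hc₂, U₂, hU₂, thr⟩ := ctRenMs_thresholds (G := G) (Q := Q) hG hQ
  obtain ⟨c₃, hc₃, U₃, hU₃, read⟩ := klLocalPart_eq_partialSumFn_of_frameOK (ctRenMs G) hR
  refine ⟨min c₂ c₃, lt_min hc₂ hc₃, fun c hc hcle => ?_⟩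
  have hu₄pos : 0 < 1 / (10 * (Q.S' 0 + 1)) := by positivity
  have hu₅pos : 0 < 3 / (4000 * (G.SL + Q.SL + 1)) := by positivity
  refine ⟨min (min U₂ U₃) (min (min (1 / (10 * (Q.S' 0 + 1))) (3 / (4000 * (G.SL + Q.SL + 1)))) 1),
    lt_min (lt_min hU₂ hU₃) (lt_min (lt_min hu₄pos hu₅pos) one_pos), ?_⟩
  intro μ hμ U hU hUle β hβ hβc Lh Mh M0 CL hCL
  have hU2 : U ≤ U₂ := hUle.trans ((min_le_left _ _).trans (min_le_left _ _))
  have hU3 : U ≤ U₃ := hUle.trans ((min_le_left _ _).trans (min_le_right _ _))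
  have hU4 : U ≤ 1 / (10 * (Q.S' 0 + 1)) := hUle.trans ((min_le_right _ _).trans ((min_le_left _ _).trans (min_le_left _ _)))
  have hU5 : U ≤ 3 / (4000 * (G.SL + Q.SL + 1)) :=
    hUle.trans ((min_le_right _ _).trans ((min_le_left _ _).trans (min_le_right _ _)))
  have hU1 : U ≤ 1 := hUle.trans ((min_le_right _ _).trans (min_le_right _ _))
  have hS0' : Q.S' 0 * |U| ≤ 1 / 10 := sPrime_zero_mul_abs_le hS'0 hU hU4
  have hq : 4 / 3 * (G.SL + Q.SL * |U|) * |U| ≤ 1 / 1000 := contraction_le hSL hSL' hU hU1 hU5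
  obtain ⟨hroomA, hroomB, h0, h1, h2⟩ := thr c U β hc.le (hcle.trans (min_le_left _ _)) hU hU2 hβ hβc
  have hroom := sharpRoom_of_rooms (G := G) (Q := Q) hR hroomA hroomB (nScales β)
  -- the construction volume: only the rates `CL n / L₀ ≤ ½·tol_n` constrain it
  have htpos : ∀ n ≤ nScales β, 0 < ctCr G * |U| * klScale klE0 n ^ 2 / klE0 / 2 := by
    intro n _
    have hUa : 0 < |U| := abs_pos.2 hU.ne'
    have hcr0 : 0 < ctCr G := by unfold ctCr; positivity
    have he0 : (0 : ℝ) < klE0 := by norm_num [klE0]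
    have hΛ : 0 < klScale klE0 n := by unfold klScale; positivity
    positivity
  obtain ⟨L₀, hL₀pos, hL₀min, hL₀rate⟩ :=
    exists_volume_threshold (N := nScales β) (a := CL) (t := fun n => ctCr G * |U| * klScale klE0 n ^ 2 / klE0 / 2)
      (fun n _ => hCL n) htpos Lh
  have hM₀pos : 0 < max (Mh L₀) (M0 L₀) + 1 := Nat.succ_pos _
  refine ⟨L₀, max (Mh L₀) (M0 L₀) + 1, hL₀pos, hM₀pos, hL₀min, (le_max_left _ _).trans (Nat.le_succ _),
    (le_max_right _ _).trans (Nat.le_succ _), fun n hn => hL₀rate n hn, ?_⟩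
  intro _ _ H blk
  -- the Jackson degree `d`: one smallness condition on the displacement
  set qq : ℝ := 4 / 3 * (G.SL + Q.SL * |U|) * |U| with hqq
  set B1 : ℝ := ∑ i ∈ range (nScales β + 1), twoLegBar G Q U 1 i with hB1
  have hB1 : 0 ≤ B1 := sum_nonneg fun i _ => twoLegBar_nonneg' hG hQ U 1 i
  have hqq0 : 0 ≤ qq := by positivity
  set t : ℝ := |U| * ((16 : ℝ) ^ nScales β)⁻¹ / 256 with ht
  have htpos' : 0 < t := by have hUa : 0 < |U| := abs_pos.2 hU.ne'; positivity
  obtain ⟨d, hd⟩ := exists_nat_gt (π ^ 6 * B1 * ((1 + qq) * (1 + 2 * qq)) / t)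
  set η : ℝ := π ^ 6 / (d + 1) * B1 with hηdef
  have hdpos : (0 : ℝ) < d + 1 := by positivity
  have hη : π ^ 6 / (d + 1) * ∑ i ∈ range (nScales β + 1), twoLegBar G Q U 1 i ≤ η := le_rfl
  have hηw : ∀ m ≤ nScales β, (1 + qq) * (1 + 2 * qq) * η ≤ |U| * ((16 : ℝ) ^ m)⁻¹ / 256 := by
    intro m hm
    -- `(1+q)(1+2q)·η ≤ t ≤ |U|16^{-m}/256`
    have hmono : t ≤ |U| * ((16 : ℝ) ^ m)⁻¹ / 256 := by
      rw [ht]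
      have : ((16 : ℝ) ^ nScales β)⁻¹ ≤ ((16 : ℝ) ^ m)⁻¹ :=
        inv_anti₀ (by positivity) (pow_le_pow_right₀ (by norm_num) hm)
      have hUa : 0 ≤ |U| := abs_nonneg U
      nlinarith
    have hkey : (1 + qq) * (1 + 2 * qq) * η ≤ t := by
      rw [hηdef]
      have hd' : π ^ 6 * B1 * ((1 + qq) * (1 + 2 * qq)) < t * d := by
        have := (div_lt_iff₀ htpos').1 hd
        linarith
      have hd1 : t * (d : ℝ) ≤ t * (d + 1) := by nlinarith
      rw [show (1 + qq) * (1 + 2 * qq) * (π ^ 6 / (d + 1) * B1) = π ^ 6 * B1 * ((1 + qq) * (1 + 2 * qq)) / (d + 1) by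
        field_simp]
      rw [div_le_iff₀ hdpos]
      linarith
    exact hkey.trans hmono
  -- the reading at the construction volume is EXACT
  have hread : ∀ K : TrigPolyC4v, FrameOK (ctRenMs G) U (nScales β) μ K → ∀ n : ℕ, n ≤ nScales β → ∀ B : ℝ,
      (∀ q : Fin 2 → ℝ, |K.eval q + ∑ i ∈ range (n + 1),
        klTwoLegPieceFn L₀ (max (Mh L₀) (M0 L₀) + 1) β U μ K.eval i q| ≤ B) →
        ∀ θ : ℝ, |klLocalPart L₀ (max (Mh L₀) (M0 L₀) + 1) β U μ K n θ| ≤ B := by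
    intro K hK n _ B hB θ
    rw [read c hc (hcle.trans (min_le_right _ _)) U hU hU3 β hβ hβc μ hμ μ K hK L₀ (max (Mh L₀) (M0 L₀) + 1) n θ]
    exact hB _
  exact ct_oneVolume_of_readingJE (L := L₀) (M := max (Mh L₀) (M0 L₀) + 1) hG hQ hμ hR rfl blk hread hS0' hq hroom h0 h1 h2 d hη hηw

end Summit.HubbardSuperconductivity.HubbardSuperconductivity.Theorems.KLRegimeSplit

end
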